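import Literature.NumberTheory.Rogawski1990.CMThetaDockingClausesTest                      -- ★ T-1 p840296 (F0P2-p01 (g9)): `CMThetaDockingClausesTest` (hypothesis = (13.1.4) ON TEST FUNCTIONS)
import Literature.NumberTheory.Rogawski1990.CMLocalAPacketMembers                          -- ★ `KeysCaseTwoLabels`, `Gqs`
import Literature.NumberTheory.GelbartRogawski1991.XiLocalPacketNonsplitThetaPair          -- ★ letter #75-loc `xiLocalPacket_nonsplit_isThetaPair` (a HYPOTHESIS here; ★ p829745 ∕ p839396 prove it)
import HarnessLib

/-!
# Crux `H413`, programme P2 — glueᵀ: every member of a non-split local packet `⟨πⁿ ∘ e, πˢ⟩` whose `πˢ` completes `πⁿ ∘ e` in (13.1.4) ON TEST FUNCTIONS is a CM theta type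
# (the Test-function twin of ★ `F0P2oD7alphaMembersThetaClass.d7alpha_members_thetaClass`, PACKET-LEVEL so that it does not wait for the record family's `hCM` re-typing)

Cell `hodgecm-mathlib` (D-0151), FLOOR 0, crux item H413 = stmt-HodgeConjecture-24833, programme P2; seat F0P2-p06 (g5), 2026-09-01; desk F0P2-plan (g9) 02:46:15Z (T-iv)
«glueᵀ `F0P2oD7alphaMembersThetaClassTest` to p06»; LEAD F0P3a-plan (g9) WORD T8-21, director s759.  THEOREMS ONLY (no `def`, no named fact, no `sorry`);
`--supports stmt-HodgeConjecture-24833`.  HONEST LABEL: HC_CM is proved only modulo the printed citations until rung 0 closes; nothing here proves a letter.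

WHY PACKET-LEVEL.  The pre-repair glue ★ `d7alpha_members_thetaClass` reads the packet of record ★ `F0P3XiPacketFamilyOfRecord.xiPacketFamilyOfRecord … hCM ξ v`, whose parameter
`hCM` produces the OLD clause `CMNonsplitCharIdentityAt` ((13.1.4) over all bare functions — print-false as typed, F0P3b-plan (g11) ∕ ★ p840152 ∕ ★ p840179); its Test re-typing
(T8-21 R4: `hCM` over ★ `CMNonsplitCharIdentityAtTest`, or the desk's D19 (2)(w-b) «supercuspidal partner DATA `hSC`») is in flux.  The mathematics of the glue needs only the SHAPE
of the record at a non-split `v` — `⟨πⁿ ∘ e, some πˢ⟩` with `(π², πⁿ)` the Keys labels, `πˢ` supercuspidal, `πˢ ≠ πⁿ ∘ e`, and the (13.1.4) identity ON TEST FUNCTIONS for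
`⟨πⁿ ∘ e, some πˢ⟩` — so it is stated here for THAT packet directly; whichever record family the repair lands instantiates it by `intro`∕`exact` with its own `_of_nonsplit`
read-back and accessors (`.πs_isSupercuspidal`, `.πs_ne`, `.charIdentityAtTest_πs`).

THE STATEMENT (`d7alpha_packet_members_thetaClassTest`).  Frame: CM `L`, hermitian `H` (`hH`, `hHd`), Rogawski's unitary `μω` on `ω_{L∕L⁺}`, local transfer data
`(Δ, mH, mG, νG, νH)`, local characters `ξloc`, a theta frame `ᵗ(c̄ g) H g = diag dV`, a one-dimensional automorphic `ξ` of `H`, a dictionary pair `(μ1, χ_f)` on the two DICTIONARY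
equations of #76, a NON-SPLIT finite `v` with a Borel Haar `μZ` on `U(Φ₃)(L⁺_v) ⧸ Z`, a form congruence `e⁻¹ = cmDatumLocalCongr L v T ha h`, Keys labels `(π², πⁿ)` with `π²`
square-integrable and `πⁿ` not, a supercuspidal `πˢ ≠ πⁿ ∘ e` with `⟨πⁿ ∘ e, some πˢ⟩.CharIdentityAtTest …`.  HYPOTHESES BY NAME: `hLoc : xiLocalPacket_nonsplit_isThetaPair` (#75-loc,
★-proved p839396) and `hDock : CMThetaDockingClausesTest L H Δ mH mG νH νG ξ μω (ξloc ξ) e₁ dV hdV hdV0 g hg` (the CONTENTFUL dock: ⟸ (D-b)ᵀ + surjective matching by ★ p840326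
`cmThetaDockingClausesTest_of_thetaWitness`).  CONCLUSION: every member `c ∈ ⟨πⁿ ∘ e, some πˢ⟩.members` is a CM theta type, `∃ ε, ThetaTypeAtCM L H e₁ dV hdV hdV0 g hg μ1 hμ1 χf ε v c`.
PROOF = the pre-repair proof verbatim: (n) `c = πⁿ ∘ e` is `hLoc`'s non-`L²` theta-type constituent (Keys: the non-`L²` constituent IS `πⁿ`); (s) `c = πˢ` is docked by `hDock`.

## References
- [Rogawski1990] J. Rogawski, *Automorphic Representations of Unitary Groups in Three Variables*, Ann. of Math. Stud. 123 — §12.2 (2) pp. 173–174; §13.1 Prop. 13.1.3 (d), Prop. 13.1.4 p. 199.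
- [GelbartRogawski1991] S. Gelbart, J. Rogawski, Invent. Math. 105 (1991) — Lem. 5.1.2 p. 466; §1.4 pp. 450–451; Cor. 5.2.2 p. 467.
-/

set_option autoImplicit false
-- the mandated namespace has the single-problem summit's repeated segment (`HodgeConjecture.HodgeConjecture`)
set_option linter.dupNamespace false

noncomputable section

open NumberField IsDedekindDomain MeasureTheory Filter Topology
open scoped Matrix MatrixGroups

open Literature.NumberTheory Literature.NumberTheory.Automorphic Literature.NumberTheory.Automorphic.UnitaryGroup
open Literature.NumberTheory.Automorphic.IdeleClassGroup
open Literature.NumberTheory.Automorphic.Liu2021 Literature.NumberTheory.Automorphic.Liu2021.Def411WeilCarriers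
open Literature.NumberTheory.Rogawski1990 Literature.NumberTheory.GaloisRepresentations
open Literature.NumberTheory.GelbartRogawski1991

namespace Summit.HodgeConjecture.HodgeConjecture.Cruxes.H413.F0P2oD7alphaMembersThetaClassTest

section Packet

variable (L : Type) [Field L] [NumberField L] [IsCMField L] (H : Matrix (Fin 3) (Fin 3) L)
  (hH : (H.map (cmConjRingHom L))ᵀ = H) (hHd : IsUnit H.det) (μω : HeckeCharacter L) (hμu : μω.IsUnitary)
  [∀ v : HeightOneSpectrum (𝓞 ↥(maximalRealSubfield L)), MeasurableSpace ((cmDatum L 3 H).Local v)]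
  [∀ v : HeightOneSpectrum (𝓞 ↥(maximalRealSubfield L)),
    MeasurableSpace ((cmDatum L 2 (Matrix.of fun i j : Fin 2 => if i.val + j.val + 1 = 2 then (1 : L) else 0)).Local v ×
      (cmDatum L 1 (Matrix.of fun i j : Fin 1 => if i.val + j.val + 1 = 1 then (1 : L) else 0)).Local v)]
  [∀ (v : HeightOneSpectrum (𝓞 ↥(maximalRealSubfield L)))
      (a : ((cmDatum L 2 (Matrix.of fun i j : Fin 2 => if i.val + j.val + 1 = 2 then (1 : L) else 0)).Local v ×
        (cmDatum L 1 (Matrix.of fun i j : Fin 1 => if i.val + j.val + 1 = 1 then (1 : L) else 0)).Local v)),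
    MeasurableSpace (((cmDatum L 2 (Matrix.of fun i j : Fin 2 => if i.val + j.val + 1 = 2 then (1 : L) else 0)).Local v ×
        (cmDatum L 1 (Matrix.of fun i j : Fin 1 => if i.val + j.val + 1 = 1 then (1 : L) else 0)).Local v) ⧸
      Subgroup.centralizer ({a} : Set ((cmDatum L 2 (Matrix.of fun i j : Fin 2 => if i.val + j.val + 1 = 2 then (1 : L) else 0)).Local v ×
        (cmDatum L 1 (Matrix.of fun i j : Fin 1 => if i.val + j.val + 1 = 1 then (1 : L) else 0)).Local v)))]
  [∀ (v : HeightOneSpectrum (𝓞 ↥(maximalRealSubfield L))) (γ : (cmDatum L 3 H).Local v),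
    MeasurableSpace ((cmDatum L 3 H).Local v ⧸ Subgroup.centralizer ({γ} : Set ((cmDatum L 3 H).Local v)))]
  (Δ : ∀ v : HeightOneSpectrum (𝓞 ↥(maximalRealSubfield L)), LocalTransferFactor L H v)
  (mH : ∀ v : HeightOneSpectrum (𝓞 ↥(maximalRealSubfield L)),
    OrbitalMeasureFamily ((cmDatum L 2 (Matrix.of fun i j : Fin 2 => if i.val + j.val + 1 = 2 then (1 : L) else 0)).Local v ×
      (cmDatum L 1 (Matrix.of fun i j : Fin 1 => if i.val + j.val + 1 = 1 then (1 : L) else 0)).Local v))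
  (mG : ∀ v : HeightOneSpectrum (𝓞 ↥(maximalRealSubfield L)), OrbitalMeasureFamily ((cmDatum L 3 H).Local v))
  (νG : ∀ v : HeightOneSpectrum (𝓞 ↥(maximalRealSubfield L)), Measure ((cmDatum L 3 H).Local v))
  (νH : ∀ v : HeightOneSpectrum (𝓞 ↥(maximalRealSubfield L)),
    Measure ((cmDatum L 2 (Matrix.of fun i j : Fin 2 => if i.val + j.val + 1 = 2 then (1 : L) else 0)).Local v ×
      (cmDatum L 1 (Matrix.of fun i j : Fin 1 => if i.val + j.val + 1 = 1 then (1 : L) else 0)).Local v))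
  (ξloc : OneDimAutRepH L → ∀ v : HeightOneSpectrum (𝓞 ↥(maximalRealSubfield L)),
    (cmDatum L 2 (Matrix.of fun i j : Fin 2 => if i.val + j.val + 1 = 2 then (1 : L) else 0)).Local v ×
      (cmDatum L 1 (Matrix.of fun i j : Fin 1 => if i.val + j.val + 1 = 1 then (1 : L) else 0)).Local v →* ℂˣ)

include hH hHd hμu in
set_option synthInstance.maxHeartbeats 400000 in
set_option maxHeartbeats 16000000 in
/-- **glueᵀ, PACKET LEVEL: every member of `⟨πⁿ ∘ e, some πˢ⟩` is a CM theta type**, for Keys labels `(π², πⁿ)` (`π²` square-integrable, `πⁿ` not), a supercuspidal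
`πˢ ≠ πⁿ ∘ e` completing `πⁿ ∘ e` in (13.1.4) ON TEST FUNCTIONS, from the local theta dichotomy #75-loc (`hLoc`) and the Test theta-docking clause (`hDock`), at a dictionary
pair `(μ1, χ_f)` of `ξ`.  (n) `πⁿ ∘ e` is `hLoc`'s non-`L²` theta-type constituent (Keys: `JH(i_G(χ_ξ)) = {πⁿ, π²}`, `π²` is `L²`, so the non-`L²` constituent IS `πⁿ`); (s) `πˢ` is
docked by `hDock`.  The Test twin of ★ `F0P2oD7alphaMembersThetaClass.d7alpha_members_thetaClass`, decoupled from the record family's `hCM` parameter.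
[cite: Rogawski1990, §12.2 (2) pp. 173–174; §13.1 Prop. 13.1.3 (d), Prop. 13.1.4 p. 199] [cite: GelbartRogawski1991, Lem. 5.1.2 p. 466; §1.4 pp. 450–451] -/
theorem d7alpha_packet_members_thetaClassTest
    (hLoc : Literature.NumberTheory.GelbartRogawski1991.xiLocalPacket_nonsplit_isThetaPair)
    {n' : ℕ} (e₁ : Fin 3 × Fin 1 ≃ Fin n') (dV : Fin 3 → L) (hdV : ∀ i, IsCMField.complexConj L (dV i) = dV i) (hdV0 : ∀ i, dV i ≠ 0) (g : GL (Fin 3) L)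
    (hg : ((g : Matrix (Fin 3) (Fin 3) L).map (cmConjRingHom L))ᵀ * H * (g : Matrix (Fin 3) (Fin 3) L) = Matrix.diagonal dV)
    (ξ : OneDimAutRepH L)
    (hDock : CMThetaDockingClausesTest L H Δ mH mG νH νG ξ μω (ξloc ξ) e₁ dV hdV hdV0 g hg)
    (hμω : ∀ x : Literature.NumberTheory.GaloisRepresentations.ideleGroup ↥(maximalRealSubfield L),
        μω (AdeleRing.ideleBaseChange (↥(maximalRealSubfield L)) L x) = quadraticHeckeCharCM L x)
    (μ1 : Literature.NumberTheory.Automorphic.IdeleClassGroup L →ₜ* Circle) (hμ1 : IsConjugateSymplectic L μ1)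
    (χf : UnitaryGroup.finAdelicOne (↥(maximalRealSubfield L)) L (IsCMField.complexConj L) →* ℂˣ)
    (hcont : Continuous χf) (hunit : ∀ z, ‖((χf z : ℂˣ) : ℂ)‖ = 1)
    -- DICTIONARY (μ): `μ̃1 = η̃⁻¹ · ψ̃⁻¹ · μω`, semi-locally at every finite place of `L⁺` (verbatim from #76)
    (hdμ : ∀ v : HeightOneSpectrum (𝓞 ↥(maximalRealSubfield L)),
        (toHeckeCharacter L μ1).semilocalComponent L v = (ξ.bcη⁻¹ * ξ.bcψ⁻¹ * μω).semilocalComponent L v)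
    -- DICTIONARY (χ_f): `χ_f (z / z̄) = (ψ̃⁻¹ · (η̃⁻¹ ψ̃⁻¹ μω)²) ((1_∞, z))` for every finite idèle `z` of `L` (verbatim from #76)
    (hdχ : ∀ z : (FiniteAdeleRing (𝓞 L) L)ˣ,
        χf (finAdelicCheck (↥(maximalRealSubfield L)) L (IsCMField.complexConj L)
            (AlgEquiv.ext fun x => by rw [AlgEquiv.mul_apply, IsCMField.complexConj_apply_apply, AlgEquiv.one_apply]) z) =
          (ξ.bcψ⁻¹ * (ξ.bcη⁻¹ * ξ.bcψ⁻¹ * μω) ^ 2)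
            (Units.map (N := AdeleRing (𝓞 L) L) (MonoidHom.inr (InfiniteAdeleRing L) (FiniteAdeleRing (𝓞 L) L)) z))
    (v : HeightOneSpectrum (𝓞 ↥(maximalRealSubfield L))) (hns : ∀ w : PlacesOver L v, IsCMField.complexConj L • w.1 = w.1)
    [MeasurableSpace (Gqs L v ⧸ Subgroup.center (Gqs L v))] [BorelSpace (Gqs L v ⧸ Subgroup.center (Gqs L v))]
    (μZ : Measure (Gqs L v ⧸ Subgroup.center (Gqs L v))) [μZ.IsHaarMeasure]
    -- the form congruence and the Keys labels at `v`
    (T : GL (Fin 3) (LocalRing L v)) (a : LocalRing L v) (ha : IsUnit a)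
    (h : formCongr (conjLocal L (IsCMField.complexConj L) v) T (H.map (algebraMap L (LocalRing L v))) =
      a • (Matrix.of fun i j : Fin 3 => if i.val + j.val + 1 = 3 then (1 : L) else 0).map (algebraMap L (LocalRing L v)))
    (π2 πn : IrrClass (Gqs L v))
    (hK : KeysCaseTwoLabels L v (μω.semilocalComponent L v) (torusLocalComponent L (IsCMField.complexConj L) v ξ.η)
      (torusLocalComponent L (IsCMField.complexConj L) v ξ.ψ) π2 πn)
    (hs2 : π2.IsSquareIntegrable μZ) (hn : ¬ πn.IsSquareIntegrable μZ)
    -- the supercuspidal partner completing `πⁿ ∘ e` in (13.1.4) ON TEST FUNCTIONS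
    (πs : IrrClass ((cmDatum L 3 H).Local v)) (hsc : πs.IsSupercuspidal) (hne : πs ≠ IrrClass.comap (cmDatumLocalCongr L v T ha h).symm πn)
    (hId : (⟨IrrClass.comap (cmDatumLocalCongr L v T ha h).symm πn, some πs⟩ : CMLocalAPacket L H v).CharIdentityAtTest L H v
      (fun c f => c.smoothTrace (νG v) f) (ξloc ξ v) (νH v) (Δ v) (mH v) (mG v))
    (c : IrrClass ((cmDatum L 3 H).Local v))
    (hc : c ∈ (⟨IrrClass.comap (cmDatumLocalCongr L v T ha h).symm πn, some πs⟩ : CMLocalAPacket L H v).members) :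
    ∃ ε : (↥(maximalRealSubfield L))ˣ, ThetaTypeAtCM L H e₁ dV hdV hdV0 g hg μ1 hμ1 χf ε v c := by
  rw [LocalAPacket.mem_members_iff] at hc
  rcases hc with hcn | hcs
  · -- (n) the Keys member `πⁿ ∘ e`: it is `hLoc`'s non-L² theta-type constituent
    obtain ⟨εn, εs, x₀, πs', hconst, hnL2, hθn, -, -, -⟩ :=
      hLoc L H hH hHd e₁ dV hdV hdV0 g hg ξ μω hμu hμω μ1 hμ1 χf hcont hunit hdμ hdχ v hns T a ha h
    have hx₀ : x₀ = πn := by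
      rcases (hK.2 x₀).1 hconst with h1 | h2
      · exact h1
      · exact absurd (h2 ▸ hs2) (hnL2 μZ)
    refine ⟨εn, ?_⟩
    rw [hx₀] at hθn
    rw [hcn]
    exact hθn
  · -- (s) the supercuspidal member completing (13.1.4) on test functions: docked by `hDock`
    have hcs' : c = πs := (Option.some_inj.1 hcs).symm
    subst hcs'
    exact hDock μ1 hμ1 χf hcont hunit hdμ hdχ v hns T a ha h μZ π2 πn hK hn _ hsc hne hId

end Packet

end Summit.HodgeConjecture.HodgeConjecture.Cruxes.H413.F0P2oD7alphaMembersThetaClassTest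

end
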